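import Mathlib

/-!
# The injectivity behind the normaliser barrier, for subsets of an abstract group

Solo-blind seat (MatrixMultiplication), companion note `LieExponent.md`, Lemma 3.14 / Theorem 3.

Blasiak–Cohn–Grochow–Pratt–Umans (arXiv:2204.03826, Thm. 3.6) prove the *normaliser barrier* for
three TPP subgroups of a finite group from one observation: `(h₁, h₂, h₃) ↦ h₁ h₂ h₃` is injective on
`H₁ × (N(H₁) ∩ H₂) × H₃` (tree, finite version:
`Literature.Barriers.MatrixMultiplication.SubgroupTPP.card_mul_card_normalizer_inf_mul_card_le`).
The Lie-group form of the barrier used in `LieExponent.md` (Lemma 3.14: for a TPP triple `(H, T, U)`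
with `H`, `T` Lie subgroups, `A ⊆ N(H) ∩ T` a connected subgroup and `U ⊇` an embedded `d`-disc,
`dim H + dim A + d ≤ dim G − 1`; hence every Borel-format triple `(T_a U⁺, T_b U⁻, S)` in `GL_n(ℝ)`
has `dim H₁ + dim H₂ + dim S ≤ 3·n(n−1)/2 + n − 1`, Theorem 3) rests on the same injectivity for
SUBSETS, plus invariance of domain (not formalised).  This file proves the two purely
group-theoretic ingredients, for an arbitrary group `G`, a subgroup `H`, a subgroup `A` normalising
`H` and contained in a subset `T`, and an arbitrary subset `S`, under the quotient-set triple
product property of `(H, T, S)` in the order `H · Q(T) · Q(S)`: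

* `soloLie_mul_eq_mul_of_tpp` / `soloLie_injOn_mul_of_tpp`: `(h, a, u) ↦ h a u` is injective on
  `H × A × S`;
* `soloLie_eq_of_tpp_of_mul_eq`: the equality-case step — if `T` is a subgroup and
  `t u₀ = h a u` with `t ∈ T`, `h ∈ H`, `a ∈ A`, `u₀, u ∈ S`, then `t = a` (and `h = 1`, `u = u₀`);
  in the Lie setting this says that an open image of `H × A × D` would force a neighbourhood of `1`
  in `T` into `A`.
-/

set_option linter.dupNamespace false

namespace Summit.MatrixMultiplication.MatrixMultiplication.Theorems

/-- Pointwise injectivity of `(h, a, u) ↦ h * a * u` on `H × A × S`, where `H` is a subgroup,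
`A` a subgroup contained in the normaliser of `H` and in the subset `T`, and `(H, T, S)` has the
quotient-set triple product property `q · (t t'⁻¹) · (s s'⁻¹) = 1 ⇒ q = 1 ∧ t = t' ∧ s = s'`
(BCGPU 2023, proof of Thm. 3.6, for subsets). -/
theorem soloLie_mul_eq_mul_of_tpp {G : Type*} [Group G] (H A : Subgroup G) (T S : Set G)
    (hAN : A ≤ Subgroup.normalizer (H : Set G)) (hAT : (A : Set G) ⊆ T)
    (tpp : ∀ q ∈ H, ∀ t ∈ T, ∀ t' ∈ T, ∀ s ∈ S, ∀ s' ∈ S,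
      q * (t * t'⁻¹) * (s * s'⁻¹) = 1 → q = 1 ∧ t = t' ∧ s = s')
    {h a u h' a' u' : G} (hh : h ∈ H) (ha : a ∈ A) (hu : u ∈ S)
    (hh' : h' ∈ H) (ha' : a' ∈ A) (hu' : u' ∈ S) (he : h * a * u = h' * a' * u') :
    h = h' ∧ a = a' ∧ u = u' := by
  have hq : a'⁻¹ * (h'⁻¹ * h) * a' ∈ H := by
    have hn : a'⁻¹ ∈ Subgroup.normalizer (H : Set G) := hAN (A.inv_mem ha')
    have := (Subgroup.mem_normalizer_iff.1 hn (h'⁻¹ * h)).1 (H.mul_mem (H.inv_mem hh') hh)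
    simpa using this
  have key : (a'⁻¹ * (h'⁻¹ * h) * a') * (a'⁻¹ * (a⁻¹)⁻¹) * (u * u'⁻¹) = 1 := by
    calc (a'⁻¹ * (h'⁻¹ * h) * a') * (a'⁻¹ * (a⁻¹)⁻¹) * (u * u'⁻¹)
        = a'⁻¹ * h'⁻¹ * (h * a * u) * u'⁻¹ := by group
      _ = a'⁻¹ * h'⁻¹ * (h' * a' * u') * u'⁻¹ := by rw [he]
      _ = 1 := by group
  obtain ⟨-, h2, h3⟩ :=
    tpp _ hq _ (hAT (A.inv_mem ha')) _ (hAT (A.inv_mem ha)) _ hu _ hu' key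
  have haa : a' = a := inv_injective h2
  subst haa
  subst h3
  refine ⟨?_, rfl, rfl⟩
  have e : h * a' * u = h' * a' * u := he
  exact mul_right_cancel (mul_right_cancel e)

/-- `Set.InjOn` form of `soloLie_mul_eq_mul_of_tpp`: multiplication is injective on
`H ×ˢ (A ×ˢ S)` (BCGPU 2023, proof of Thm. 3.6, for subsets). -/
theorem soloLie_injOn_mul_of_tpp {G : Type*} [Group G] (H A : Subgroup G) (T S : Set G)
    (hAN : A ≤ Subgroup.normalizer (H : Set G)) (hAT : (A : Set G) ⊆ T)
    (tpp : ∀ q ∈ H, ∀ t ∈ T, ∀ t' ∈ T, ∀ s ∈ S, ∀ s' ∈ S,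
      q * (t * t'⁻¹) * (s * s'⁻¹) = 1 → q = 1 ∧ t = t' ∧ s = s') :
    Set.InjOn (fun x : G × G × G => x.1 * x.2.1 * x.2.2)
      ((H : Set G) ×ˢ ((A : Set G) ×ˢ S)) := by
  rintro ⟨h, a, u⟩ hx ⟨h', a', u'⟩ hy hxy
  simp only [Set.mem_prod, SetLike.mem_coe] at hx hy
  obtain ⟨hh, ha, hu⟩ := hx
  obtain ⟨hh', ha', hu'⟩ := hy
  obtain ⟨e1, e2, e3⟩ :=
    soloLie_mul_eq_mul_of_tpp H A T S hAN hAT tpp hh ha hu hh' ha' hu' hxy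
  subst e1; subst e2; subst e3
  rfl

/-- The equality-case step of Lemma 3.14: with `T` a subgroup containing `A`, if
`t * u₀ = h * a * u` with `t ∈ T`, `h ∈ H`, `a ∈ A`, `u₀ u ∈ S`, then `t = a`, `h = 1` and
`u = u₀` (so a product set `H · A · S` containing `T · u₀` forces `T ⊆ A`). -/
theorem soloLie_eq_of_tpp_of_mul_eq {G : Type*} [Group G] (H A T : Subgroup G) (S : Set G)
    (hAN : A ≤ Subgroup.normalizer (H : Set G)) (hAT : A ≤ T)
    (tpp : ∀ q ∈ H, ∀ t ∈ T, ∀ t' ∈ T, ∀ s ∈ S, ∀ s' ∈ S,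
      q * (t * t'⁻¹) * (s * s'⁻¹) = 1 → q = 1 ∧ t = t' ∧ s = s')
    {t h a u₀ u : G} (ht : t ∈ T) (hh : h ∈ H) (ha : a ∈ A) (hu₀ : u₀ ∈ S) (hu : u ∈ S)
    (he : t * u₀ = h * a * u) : t = a ∧ h = 1 ∧ u = u₀ := by
  have hq : a⁻¹ * h⁻¹ * a ∈ H := by
    have hn : a⁻¹ ∈ Subgroup.normalizer (H : Set G) := hAN (A.inv_mem ha)
    have := (Subgroup.mem_normalizer_iff.1 hn h⁻¹).1 (H.inv_mem hh)
    simpa [mul_assoc] using this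
  have key : (a⁻¹ * h⁻¹ * a) * (a⁻¹ * (t⁻¹)⁻¹) * (u₀ * u⁻¹) = 1 := by
    calc (a⁻¹ * h⁻¹ * a) * (a⁻¹ * (t⁻¹)⁻¹) * (u₀ * u⁻¹)
        = a⁻¹ * h⁻¹ * (t * u₀) * u⁻¹ := by group
      _ = a⁻¹ * h⁻¹ * (h * a * u) * u⁻¹ := by rw [he]
      _ = 1 := by group
  obtain ⟨h1, h2, h3⟩ :=
    tpp _ hq _ (hAT (A.inv_mem ha)) _ (T.inv_mem ht) _ hu₀ _ hu key
  have hta : t = a := (inv_injective h2).symm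
  refine ⟨hta, ?_, h3.symm⟩
  have : h⁻¹ = 1 := by
    have e : a⁻¹ * h⁻¹ * a = 1 := h1
    have := congrArg (fun x => a * x * a⁻¹) e
    simpa [mul_assoc] using this
  exact inv_eq_one.1 this

end Summit.MatrixMultiplication.MatrixMultiplication.Theorems
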